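import Mathlib

/-!
# Schur test for integral operators, `ℝ≥0∞` form (solo-blind kernel #177)

Paper `steady-zeroth-law.md` §24.104.  The bridge certificate is a statement about the EXACT periodic Volterra (loop)
operator `(𝒦 q)(t) = ∫ k(t, s) q(s) ds`, not about its Nyström discretisation: what the kernel boxes deliver is a pointwise
envelope `|k| ≤ E` with row integrals `≤ r` and column integrals `≤ c`.  This file is the measure-theoretic Schur test that
turns such an envelope into the `L²` bound `‖𝒦 q‖₂² ≤ r c ‖q‖₂²` (kernel #175 is the matrix version).  Everything is stated
with lower Lebesgue integrals of `ℝ≥0∞`-valued functions, so no integrability side conditions arise; apply it to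
`K = ‖k‖ₑ`, `f = ‖q‖ₑ`.

* `schurInt_pointwise` — weighted Cauchy–Schwarz `(∫ K f)² ≤ (∫ K) · ∫ K f²`;
* `schurInt_sq_le` — `∫_x (∫_y K(x,y) f(y))² ≤ r c ∫ f²` from `∫_y K(x,·) ≤ r` (all `x`) and `∫_x K(·,y) ≤ c` (all `y`).

Relation to the tree: `Literature.Analysis.Hypoelliptic.schur_test` is the same inequality for ONE
finite-dimensional inner-product space with `volume` in both variables; the loop operator needs two different measure
spaces `(X, μ)`, `(Y, ν)` (time on the period circle, lag with a weight), which is the generality stated here.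
-/

namespace Summit.AnomalousDissipation.AnomalousDissipation.Theorems

open MeasureTheory ENNReal

section

variable {Y : Type*} [MeasurableSpace Y] (ν : Measure Y)

/-- Weighted Cauchy–Schwarz for lower integrals: `(∫ K f)² ≤ (∫ K) (∫ K f²)`. -/
theorem schurInt_pointwise (K f : Y → ℝ≥0∞) (hK : AEMeasurable K ν) (hf : AEMeasurable f ν) :
    (∫⁻ y, K y * f y ∂ν) ^ 2 ≤ (∫⁻ y, K y ∂ν) * ∫⁻ y, K y * f y ^ 2 ∂ν := by
  have h2 : Real.HolderConjugate 2 2 := by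
    rw [Real.holderConjugate_iff]; norm_num
  set a : Y → ℝ≥0∞ := fun y => K y ^ (1 / 2 : ℝ) with ha_def
  set b : Y → ℝ≥0∞ := fun y => K y ^ (1 / 2 : ℝ) * f y with hb_def
  have ha : AEMeasurable a ν := hK.pow_const _
  have hb : AEMeasurable b ν := (hK.pow_const _).mul hf
  have hhalf : ∀ y, K y ^ (1 / 2 : ℝ) * K y ^ (1 / 2 : ℝ) = K y := by
    intro y; rw [← ENNReal.rpow_add_of_nonneg _ _ (by norm_num) (by norm_num)]; norm_num
  have hab : ∀ y, K y * f y = a y * b y := by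
    intro y; simp only [ha_def, hb_def]; rw [← mul_assoc, hhalf]
  have ha2 : ∀ y, a y ^ (2 : ℝ) = K y := by
    intro y; simp only [ha_def]; rw [← ENNReal.rpow_mul]; norm_num
  have hb2 : ∀ y, b y ^ (2 : ℝ) = K y * f y ^ 2 := by
    intro y; simp only [hb_def]
    rw [ENNReal.mul_rpow_of_nonneg _ _ (by norm_num : (0 : ℝ) ≤ 2), ← ENNReal.rpow_mul]
    norm_num
  have H := ENNReal.lintegral_mul_le_Lp_mul_Lq ν h2 ha hb
  simp only [ha2, hb2] at H
  have H' : ∫⁻ y, K y * f y ∂ν ≤ (∫⁻ y, K y ∂ν) ^ (1 / 2 : ℝ) * (∫⁻ y, K y * f y ^ 2 ∂ν) ^ (1 / 2 : ℝ) := by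
    calc ∫⁻ y, K y * f y ∂ν = ∫⁻ y, a y * b y ∂ν := lintegral_congr fun y => hab y
      _ ≤ _ := by simpa using H
  calc (∫⁻ y, K y * f y ∂ν) ^ 2
      ≤ ((∫⁻ y, K y ∂ν) ^ (1 / 2 : ℝ) * (∫⁻ y, K y * f y ^ 2 ∂ν) ^ (1 / 2 : ℝ)) ^ 2 := by gcongr
    _ = (∫⁻ y, K y ∂ν) * ∫⁻ y, K y * f y ^ 2 ∂ν := by
        rw [mul_pow, ← ENNReal.rpow_mul_natCast, ← ENNReal.rpow_mul_natCast]; norm_num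

end

section

variable {X Y : Type*} [MeasurableSpace X] [MeasurableSpace Y] (μ : Measure X) (ν : Measure Y) [SFinite μ] [SFinite ν]

/-- **Schur test** (`ℝ≥0∞` form).  If `K ≥ 0` is jointly measurable with `∫_y K(x,y) ≤ r` for every `x` and
`∫_x K(x,y) ≤ c` for every `y`, then `∫_x (∫_y K(x,y) f(y))² ≤ r c ∫_y f(y)²`. -/
theorem schurInt_sq_le (K : X → Y → ℝ≥0∞) (hK : Measurable (Function.uncurry K)) (f : Y → ℝ≥0∞) (hf : Measurable f)
    (r c : ℝ≥0∞) (hrow : ∀ x, ∫⁻ y, K x y ∂ν ≤ r) (hcol : ∀ y, ∫⁻ x, K x y ∂μ ≤ c) :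
    ∫⁻ x, (∫⁻ y, K x y * f y ∂ν) ^ 2 ∂μ ≤ r * c * ∫⁻ y, f y ^ 2 ∂ν := by
  have hKx : ∀ x, Measurable fun y => K x y := fun x => hK.comp (measurable_const.prodMk measurable_id)
  have hKy : ∀ y, Measurable fun x => K x y := fun y => hK.comp (measurable_id.prodMk measurable_const)
  have hKf2 : Measurable (Function.uncurry fun x y => K x y * f y ^ 2) :=
    hK.mul ((hf.pow_const 2).comp measurable_snd)
  calc ∫⁻ x, (∫⁻ y, K x y * f y ∂ν) ^ 2 ∂μ
      ≤ ∫⁻ x, (∫⁻ y, K x y ∂ν) * ∫⁻ y, K x y * f y ^ 2 ∂ν ∂μ :=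
        lintegral_mono fun x => schurInt_pointwise ν (K x) f (hKx x).aemeasurable hf.aemeasurable
    _ ≤ ∫⁻ x, r * ∫⁻ y, K x y * f y ^ 2 ∂ν ∂μ := lintegral_mono fun x => mul_le_mul' (hrow x) le_rfl
    _ = r * ∫⁻ x, ∫⁻ y, K x y * f y ^ 2 ∂ν ∂μ := lintegral_const_mul r hKf2.lintegral_prod_right'
    _ = r * ∫⁻ y, ∫⁻ x, K x y * f y ^ 2 ∂μ ∂ν := by rw [lintegral_lintegral_swap hKf2.aemeasurable]
    _ = r * ∫⁻ y, (∫⁻ x, K x y ∂μ) * f y ^ 2 ∂ν := by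
        congr 1; refine lintegral_congr fun y => ?_; rw [lintegral_mul_const _ (hKy y)]
    _ ≤ r * ∫⁻ y, c * f y ^ 2 ∂ν := by gcongr with y; exact hcol y
    _ = r * c * ∫⁻ y, f y ^ 2 ∂ν := by rw [lintegral_const_mul c (hf.pow_const 2), mul_assoc]

end

end Summit.AnomalousDissipation.AnomalousDissipation.Theorems
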